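import Summits.SmoothPoincare4.SmoothPoincare4.Theses.CongruenceShadows
import Summits.SmoothPoincare4.SmoothPoincare4.Theorems.CongruenceShadowsHeegaardHandlebodyCongruenceClosedStubRegluingDepth

/-!
# Stub P3 partial — the glued group of a fine limit is PERFECT
# (line `pair-rigidity-retraction`, crux `CongruenceShadows.HeegaardHandlebodyCongruenceClosed`, stmt-SmoothPoincare4-14596)

Notation: `S = S_{3+3m}`, `N = (N₀,N₁,N₂) = s4Kernels.stabilizeIter m`, `T_ρ = N₀ ⊔ N₁ ⊔ ρN₂`,
`G_ρ = S ⧸ T_ρ` (the fundamental group of the 4-manifold reglued along `ρ`), "product-congruent" = the crux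
hypothesis on `ρ`.  The landed level collapse (`hom_trivial_of_productCongruent`) says `G_ρ` has no non-trivial
FINITE quotient.  Here we add the step every "ghost" analysis uses informally: `G_ρ` has no non-trivial ABELIAN
quotient either (finite or not), i.e. `G_ρ` is perfect — because `G_ρ` is finitely generated and a non-trivial
finitely generated abelian group has a non-trivial finite cyclic quotient (a maximal proper subgroup exists by
coatomicity of finitely generated `ℤ`-modules, and the simple quotient is `ℤ ⧸ (p)`).

* `exists_surjective_zmod_of_fg` — a non-trivial finitely generated commutative group surjects onto
  `Multiplicative (ZMod n)` for some `n > 1`.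
* `p3_hom_commGroup_trivial` — for a product-congruent `ρ`, every homomorphism from `S` to a commutative group
  (in `Type`) that kills `T_ρ` is trivial.
* `p3_commutator_gluedQuotient_eq_top` — `G_ρ` is perfect: `commutator (S ⧸ T_ρ) = ⊤`.
* `p3_tripleJoin_sup_commutator_eq_top` — equivalently `T_ρ ⊔ [S,S] = ⊤` (the abelian level never sees a ghost).
-/

noncomputable section

-- the prescribed namespace `Summit.<P>.<Sub>.…` duplicates `SmoothPoincare4` (P = Sub)
set_option linter.dupNamespace false

namespace Summit.SmoothPoincare4.SmoothPoincare4.Theorems.HeegaardHandlebodyCongruenceClosed.PairRigidityRetraction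

open Literature.Topology.FourManifolds Subgroup

/-! ## Finitely generated abelian groups have finite cyclic quotients -/

/-- A non-trivial finitely generated commutative group surjects onto the cyclic group `ZMod n` (written
multiplicatively) for some `n > 1`: a maximal proper subgroup exists (finitely generated `ℤ`-modules are
coatomic) and the simple quotient is `ℤ ⧸ (a)` with `a` neither zero (`ℤ` is not a field) nor a unit. [folklore] -/
theorem exists_surjective_zmod_of_fg (A : Type*) [CommGroup A] [Group.FG A] [Nontrivial A] :
    ∃ n : ℕ, 1 < n ∧ ∃ φ : A →* Multiplicative (ZMod n), Function.Surjective φ := by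
  haveI : Module.Finite ℤ (Additive A) := Module.Finite.iff_addGroup_fg.mpr inferInstance
  obtain ⟨P, hP⟩ : ∃ P : Submodule ℤ (Additive A), IsCoatom P := by
    rcases eq_top_or_exists_le_coatom (⊥ : Submodule ℤ (Additive A)) with h | ⟨P, hP, -⟩
    · exact absurd h bot_ne_top
    · exact ⟨P, hP⟩
  haveI : IsSimpleModule ℤ (Additive A ⧸ P) := isSimpleModule_iff_isCoatom.mpr hP
  obtain ⟨I, hI, ⟨e⟩⟩ := isSimpleModule_iff_quot_maximal.mp this
  obtain ⟨a, ha⟩ : ∃ a : ℤ, I = Ideal.span {a} :=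
    ⟨Submodule.IsPrincipal.generator I, (Ideal.span_singleton_generator I).symm⟩
  subst ha
  have ha0 : a ≠ 0 := by
    rintro rfl
    have hbot : (Ideal.span {(0 : ℤ)} : Ideal ℤ) = ⊥ := by simp
    rw [hbot] at hI
    exact Int.not_isField (Ring.isField_iff_maximal_bot.mpr hI)
  have ha1 : a.natAbs ≠ 1 := by
    intro h1
    exact hI.ne_top (Ideal.span_singleton_eq_top.mpr (Int.isUnit_iff_natAbs_eq.mpr h1))
  refine ⟨a.natAbs, ?_, ?_⟩
  · have : a.natAbs ≠ 0 := Int.natAbs_ne_zero.mpr ha0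
    omega
  · let q : Additive A →+ ZMod a.natAbs :=
      ((Int.quotientSpanEquivZMod a).toAddMonoidHom.comp e.toLinearMap.toAddMonoidHom).comp
        P.mkQ.toAddMonoidHom
    have hq : Function.Surjective q := by
      refine (Int.quotientSpanEquivZMod a).surjective.comp (e.surjective.comp ?_)
      exact Submodule.mkQ_surjective P
    exact ⟨AddMonoidHom.toMultiplicativeRight q, hq⟩

/-! ## `G_ρ` is perfect -/

/-- The surface group `S_g` is finitely generated (a quotient of the free group on `2g` letters). [folklore] -/
theorem fg_surfaceGroup (g : ℕ) : Group.FG (SurfaceGroup g) :=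
  Group.fg_of_surjective (PresentedGroup.mk_surjective ({surfaceRelator g} : Set (FreeGroup (surfaceGen g))))

/-- **No abelian quotients.** For a product-congruent `ρ`, every homomorphism from `S` to a commutative group
killing `T_ρ = N₀ ⊔ N₁ ⊔ ρN₂` is trivial: its image is a finitely generated abelian group, which — if non-trivial —
would surject onto a non-trivial finite cyclic group, contradicting the level collapse
`hom_trivial_of_productCongruent`. [folklore] -/
theorem p3_hom_commGroup_trivial {m : ℕ} {ρ : SurfaceGroup (3 + 3 * m) ≃* SurfaceGroup (3 + 3 * m)}
    (h : ∀ M : Subgroup (SurfaceGroup (3 + 3 * m)), M.Characteristic → M.FiniteIndex →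
      ∃ x c : SurfaceGroup (3 + 3 * m) ≃* SurfaceGroup (3 + 3 * m),
        (s4Kernels.stabilizeIter m 0).map x.toMonoidHom = s4Kernels.stabilizeIter m 0 ∧
        (s4Kernels.stabilizeIter m 1).map x.toMonoidHom = s4Kernels.stabilizeIter m 1 ∧
        (s4Kernels.stabilizeIter m 2).map c.toMonoidHom = s4Kernels.stabilizeIter m 2 ∧
        ∀ s, ρ s * (x (c s))⁻¹ ∈ M)
    {A : Type} [CommGroup A] (f : SurfaceGroup (3 + 3 * m) →* A)
    (hf : s4Kernels.stabilizeIter m 0 ⊔ s4Kernels.stabilizeIter m 1 ⊔ (s4Kernels.stabilizeIter m 2).map ρ.toMonoidHom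
      ≤ f.ker) (s : SurfaceGroup (3 + 3 * m)) : f s = 1 := by
  by_contra hs
  haveI := fg_surfaceGroup (3 + 3 * m)
  haveI : Nontrivial f.range :=
    ⟨⟨⟨f s, ⟨s, rfl⟩⟩, 1, fun heq => hs (by simpa using congrArg Subtype.val heq)⟩⟩
  obtain ⟨n, hn, φ, hφ⟩ := exists_surjective_zmod_of_fg f.range
  haveI : NeZero n := ⟨by omega⟩
  haveI : Nontrivial (ZMod n) := ZMod.nontrivial_iff.mpr (by omega)
  -- the composite `S → f.range → ZMod n` kills `T_ρ`, so it is trivial by level collapse …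
  have hker : s4Kernels.stabilizeIter m 0 ⊔ s4Kernels.stabilizeIter m 1 ⊔
      (s4Kernels.stabilizeIter m 2).map ρ.toMonoidHom ≤ (φ.comp f.rangeRestrict).ker := by
    intro t ht
    have hft : f t = 1 := hf ht
    have : f.rangeRestrict t = 1 := Subtype.ext (by simpa using hft)
    simp [MonoidHom.mem_ker, this]
  have htriv := hom_trivial_of_productCongruent h (φ.comp f.rangeRestrict) hker
  -- … but it is surjective onto a non-trivial group
  obtain ⟨t, ht⟩ := (hφ.comp f.rangeRestrict_surjective) (Multiplicative.ofAdd (1 : ZMod n))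
  have h1 : (Multiplicative.ofAdd (1 : ZMod n)) = 1 := by
    rw [← ht]; exact htriv t
  have h0 : (1 : ZMod n) = 0 := by
    rw [← toAdd_ofAdd (1 : ZMod n), h1, toAdd_one]
  exact one_ne_zero h0

/-- **`G_ρ` is perfect.** For a product-congruent `ρ` the glued group `G_ρ = S ⧸ (N₀ ⊔ N₁ ⊔ ρN₂)` equals its own
commutator subgroup: its abelianisation receives a homomorphism from `S` killing `T_ρ`, hence is trivial. So a
counterexample to "limits are simply connected" is an infinite, finitely presented, PERFECT group without finite
quotients (Higman–Kervaire type), never merely a group without finite quotients. [folklore] -/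
theorem p3_commutator_gluedQuotient_eq_top {m : ℕ} {ρ : SurfaceGroup (3 + 3 * m) ≃* SurfaceGroup (3 + 3 * m)}
    (h : ∀ M : Subgroup (SurfaceGroup (3 + 3 * m)), M.Characteristic → M.FiniteIndex →
      ∃ x c : SurfaceGroup (3 + 3 * m) ≃* SurfaceGroup (3 + 3 * m),
        (s4Kernels.stabilizeIter m 0).map x.toMonoidHom = s4Kernels.stabilizeIter m 0 ∧
        (s4Kernels.stabilizeIter m 1).map x.toMonoidHom = s4Kernels.stabilizeIter m 1 ∧
        (s4Kernels.stabilizeIter m 2).map c.toMonoidHom = s4Kernels.stabilizeIter m 2 ∧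
        ∀ s, ρ s * (x (c s))⁻¹ ∈ M) :
    haveI := normal_tripleJoin m ρ
    commutator (SurfaceGroup (3 + 3 * m) ⧸ (s4Kernels.stabilizeIter m 0 ⊔ s4Kernels.stabilizeIter m 1 ⊔
      (s4Kernels.stabilizeIter m 2).map ρ.toMonoidHom)) = ⊤ := by
  haveI := normal_tripleJoin m ρ
  set T := s4Kernels.stabilizeIter m 0 ⊔ s4Kernels.stabilizeIter m 1 ⊔
      (s4Kernels.stabilizeIter m 2).map ρ.toMonoidHom with hT
  -- the abelianisation map of `G_ρ`, pulled back to `S`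
  let f : SurfaceGroup (3 + 3 * m) →* Abelianization (SurfaceGroup (3 + 3 * m) ⧸ T) :=
    Abelianization.of.comp (QuotientGroup.mk' T)
  have hf : T ≤ f.ker := by
    intro t ht
    simp only [f, MonoidHom.mem_ker, MonoidHom.coe_comp, Function.comp_apply, QuotientGroup.mk'_apply,
      (QuotientGroup.eq_one_iff t).mpr ht, map_one]
  have htriv := p3_hom_commGroup_trivial h f hf
  rw [eq_top_iff]
  intro q _
  obtain ⟨s, rfl⟩ := QuotientGroup.mk_surjective q
  have : Abelianization.of (QuotientGroup.mk s : SurfaceGroup (3 + 3 * m) ⧸ T) = 1 := htriv s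
  rw [← MonoidHom.mem_ker, Abelianization.ker_of] at this
  exact this

/-- **The abelian level never sees a ghost.** Equivalently, `T_ρ ⊔ [S,S] = ⊤`: the image of `T_ρ` fills the
whole of `H₁(S) = S ⧸ [S,S] ≅ ℤ^{2g}` (not only every `H₁(S; ℤ/n)`, which is what level collapse at the abelian levels
gives directly). [folklore] -/
theorem p3_tripleJoin_sup_commutator_eq_top {m : ℕ} {ρ : SurfaceGroup (3 + 3 * m) ≃* SurfaceGroup (3 + 3 * m)}
    (h : ∀ M : Subgroup (SurfaceGroup (3 + 3 * m)), M.Characteristic → M.FiniteIndex →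
      ∃ x c : SurfaceGroup (3 + 3 * m) ≃* SurfaceGroup (3 + 3 * m),
        (s4Kernels.stabilizeIter m 0).map x.toMonoidHom = s4Kernels.stabilizeIter m 0 ∧
        (s4Kernels.stabilizeIter m 1).map x.toMonoidHom = s4Kernels.stabilizeIter m 1 ∧
        (s4Kernels.stabilizeIter m 2).map c.toMonoidHom = s4Kernels.stabilizeIter m 2 ∧
        ∀ s, ρ s * (x (c s))⁻¹ ∈ M) :
    (s4Kernels.stabilizeIter m 0 ⊔ s4Kernels.stabilizeIter m 1 ⊔ (s4Kernels.stabilizeIter m 2).map ρ.toMonoidHom) ⊔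
      commutator (SurfaceGroup (3 + 3 * m)) = ⊤ := by
  haveI := normal_tripleJoin m ρ
  set T := s4Kernels.stabilizeIter m 0 ⊔ s4Kernels.stabilizeIter m 1 ⊔
      (s4Kernels.stabilizeIter m 2).map ρ.toMonoidHom with hT
  haveI : (T ⊔ commutator (SurfaceGroup (3 + 3 * m))).Normal := Subgroup.sup_normal _ _
  -- `S → Abelianization S → (Abelianization S) ⧸ image of T` is a hom to a commutative group killing `T`
  let A := Abelianization (SurfaceGroup (3 + 3 * m)) ⧸ (T.map (Abelianization.of : SurfaceGroup (3 + 3 * m) →* _))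
  let f : SurfaceGroup (3 + 3 * m) →* A := (QuotientGroup.mk' _).comp Abelianization.of
  have hf : T ≤ f.ker := by
    intro t ht
    rw [MonoidHom.mem_ker, MonoidHom.coe_comp, Function.comp_apply, QuotientGroup.mk'_apply,
      QuotientGroup.eq_one_iff]
    exact ⟨t, ht, rfl⟩
  have htriv := p3_hom_commGroup_trivial h f hf
  rw [eq_top_iff]
  intro s _
  have hs : f s = 1 := htriv s
  rw [MonoidHom.coe_comp, Function.comp_apply, QuotientGroup.mk'_apply, QuotientGroup.eq_one_iff,
    Subgroup.mem_map] at hs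
  obtain ⟨t, ht, hts⟩ := hs
  -- `s = t · (t⁻¹ s)` with `t ∈ T` and `t⁻¹ s ∈ [S,S]`
  have hmem : t⁻¹ * s ∈ commutator (SurfaceGroup (3 + 3 * m)) := by
    rw [← Abelianization.ker_of, MonoidHom.mem_ker, map_mul, map_inv, hts, inv_mul_cancel]
  have : s = t * (t⁻¹ * s) := by group
  rw [this]
  exact Subgroup.mul_mem _ (Subgroup.mem_sup_left ht) (Subgroup.mem_sup_right hmem)


/-! ## Registered form -/

/-- **Registered helper stub `stub_gluedGroupPerfect`** (signature verbatim as registered on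
stmt-SmoothPoincare4-14596): for a product-congruent `ρ`, `T_ρ ⊔ [S,S] = ⊤` — the glued group `G_ρ` is perfect.
`= p3_tripleJoin_sup_commutator_eq_top`. [folklore] -/
theorem stub_gluedGroupPerfect : ∀ (m : ℕ) (ρ : Literature.Topology.FourManifolds.SurfaceGroup (3 + 3 * m) ≃* Literature.Topology.FourManifolds.SurfaceGroup (3 + 3 * m)), (∀ M : Subgroup (Literature.Topology.FourManifolds.SurfaceGroup (3 + 3 * m)), M.Characteristic → M.FiniteIndex → ∃ x c : Literature.Topology.FourManifolds.SurfaceGroup (3 + 3 * m) ≃* Literature.Topology.FourManifolds.SurfaceGroup (3 + 3 * m), (Literature.Topology.FourManifolds.s4Kernels.stabilizeIter m 0).map x.toMonoidHom = Literature.Topology.FourManifolds.s4Kernels.stabilizeIter m 0 ∧ (Literature.Topology.FourManifolds.s4Kernels.stabilizeIter m 1).map x.toMonoidHom = Literature.Topology.FourManifolds.s4Kernels.stabilizeIter m 1 ∧ (Literature.Topology.FourManifolds.s4Kernels.stabilizeIter m 2).map c.toMonoidHom = Literature.Topology.FourManifolds.s4Kernels.stabilizeIter m 2 ∧ ∀ s,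 ρ s * (x (c s))⁻¹ ∈ M) → (Literature.Topology.FourManifolds.s4Kernels.stabilizeIter m 0 ⊔ Literature.Topology.FourManifolds.s4Kernels.stabilizeIter m 1 ⊔ (Literature.Topology.FourManifolds.s4Kernels.stabilizeIter m 2).map ρ.toMonoidHom) ⊔ commutator (Literature.Topology.FourManifolds.SurfaceGroup (3 + 3 * m)) = ⊤ :=
  fun _ _ h => p3_tripleJoin_sup_commutator_eq_top h

end Summit.SmoothPoincare4.SmoothPoincare4.Theorems.HeegaardHandlebodyCongruenceClosed.PairRigidityRetraction

end
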